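/-
Copyright (c) 2026 the pub-hodgecm-mathlib formalisation cell (harness21).  Prover seat hodgecm-mathlib-K2E1-p03 (g2), Track B ∕ K2-LIT (stream 29),
h413 = `stmt-HodgeConjecture-24833`, line `K2_E1_TraceFormulaBeta`, helper `K2E1GroundFieldChangeLocalIso` (dealer K2E1-plan (g0) BY-NAME DEAL (3)
2026-09-03T22:29:23Z; row 21 `K2E1TransportRealQuadratic`, SURVEY-2 §21's missing piece): transport of the local unitary group `U(H)(L⁺_𝔭)` along an
isomorphism of LOCAL data `L ⊗ L⁺_𝔭 ≃ L' ⊗ L'⁺_𝔓` (ground-field change at a degree-one place).  2026-09-03.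
-/
import Literature.NumberTheory.Automorphic.LocalUnitaryIntegralLevel          -- ★ `cmLocalIntegralLevel`, `mem_localIntegralLevel_iff`, carriers `UnitaryGroup.«local»`, `cmDatum`
import Literature.NumberTheory.Automorphic.IrreducibleClassesComapSpherical    -- ★ `IrrClass.comap`, `comap_bijective`, `isAdmissible_comap_iff`, `isSpherical_comap_iff_of_map_eq`
import Literature.NumberTheory.Automorphic.UnitaryGroupRestrictedProduct       -- ★ `ContinuousMulEquiv.restrictSubgroup`
import Literature.NumberTheory.Automorphic.AdicCompletionDegreeOnePlaceEquiv   -- ★ `adicCompletionEquivOfDegreeOne : F_v ≃+* K_w` (e = f = 1) — clause (i), cited by name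
import HarnessLib

/-!
# h413 ∕ Track B «K2-LIT», line `K2_E1_TraceFormulaBeta`, row 21: GROUND-FIELD CHANGE OF THE LOCAL UNITARY GROUP — `U(H)(L⁺_𝔭) ≃ₜ* U(H')(L'⁺_𝔓)` ALONG AN
# ISOMORPHISM OF LOCAL DATA (helper `K2E1GroundFieldChangeLocalIso`, BY-NAME DEAL (3) of K2E1-plan (g0), `K2/STATUS.md` 2026-09-03T22:29:23Z)

Cell `pub/hodgecm-mathlib`, crux H413 = `stmt-HodgeConjecture-24833`, route `HCCMUnconditional`; chair K2-lead (g0), dealer K2E1-plan (g0).  THEOREMS ONLY (kernel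
lane: no `def`, no `instance`, no `notation`, no named-fact hypothesis, no `sorry` — the isomorphisms are delivered as `∃ e : _ ≃ₜ* _, <matrix formula>`); lane
`--supports stmt-HodgeConjecture-24833 --as helper` (count-neutral).

THE DEAL (row 21 «letter at `(L·K, 𝔓)` ⇒ letter at `(L, 𝔭)`», SURVEY-2 §21: «MISSING: the base-change-of-ground-field isomorphism `U_{L/L⁺}(H)(L⁺_𝔭) ≅
U_{LK/K}(H)(K_𝔓)` … a `ContinuousMulEquiv` between the two `cmDatum … .Local` groups commuting with `cmLocalIntegralLevel`, then by ★ `IrrClass.comap`»).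
(i) the completion isomorphism `L⁺_𝔭 ≃ K'_𝔓` at a place `𝔓 ∣ 𝔭` with `e = f = 1` IS ★ BY NAME: ★ `Literature.NumberTheory.Automorphic.adicCompletionEquivOfDegreeOne
F K v w he hf : F_v ≃+* K_w` (+ `adicCompletionHomeomorphOfDegreeOne`, `unitsAdicCompletionEquivOfDegreeOne : F_vˣ ≃ₜ* K_wˣ`, `…_coe` (extends `F → K`),
`norm_adicCompletionOfLiesOver_of_degree_one` (isometry, hence `𝒪 ↦ 𝒪`), existence form ★ `AdicCompletionDegreeOnePlaceProofs`).  (ii)+(iii) are proved here FROM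
AN EXPLICIT ISOMORPHISM OF LOCAL DATA, as the dealer allowed («land (ii)+(iii) from an explicit valued-field isomorphism hypothesis + compatibility with `L ⊗`, and
say so»): the local unitary group `U(J)(F_v) = UnitaryGroup.«local» E c N J v ≤ GL_N(E_v)`, `E_v := Π_{w ∣ v} E_w` (★ `UnitaryGroup.LocalRing E v`), depends only on the
LOCAL DATUM `(E_v, c ⊗ 1 = conjLocal E c v, J ⊗ 1)`, so an isomorphism of local data
  `Φ : LocalRing E v ≃+* LocalRing E' v'`, bicontinuous, `Φ ∘ (c ⊗ 1) = (c' ⊗ 1) ∘ Φ`, `Φ(J ⊗ 1) = J' ⊗ 1`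
induces `U(J)(F_v) ≃ₜ* U(J')(F'_{v'})`, `g ↦ Φ(g)` entrywise (§1–§2); if `Φ` matches integers (`Φ(x)` integral at every `w' ∣ v'` iff `x` integral at every `w ∣ v`)
it carries `U(J)(𝒪_v)` ONTO `U(J')(𝒪_{v'})` (§3); hence by ★ `IrrClass.comap` the irreducible classes, admissible classes and unramified (spherical) classes of the two
local groups correspond (§4).  §5 dresses everything in the K2·E1 CM currency `(cmDatum L N H).Local 𝔭`, `cmLocalIntegralLevel` (`cmDatum_Local` is `rfl`).

WHAT SUPPLIES `Φ` IN ROW 21 (not constructed here — stated precisely so the row's DEFS leaf can build it): `L` CM, `K` real quadratic, `L' = L·K` (CM with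
`L'⁺ = L⁺·K`), `𝔓` a place of `L'⁺` over `𝔭` of `L⁺` with `e(𝔓|𝔭) = f(𝔓|𝔭) = 1`; then `w' ↦ w' ∩ L` is a bijection `PlacesOver L' 𝔓 ≃ PlacesOver L 𝔭` with
`e(w'|w) = f(w'|w) = 1`, and `Φ := Π_{w'} adicCompletionEquivOfDegreeOne L L' w w'` (★, componentwise; bicontinuous by ★ `adicCompletionHomeomorphOfDegreeOne`;
extends `L → L'` by ★ `…_coe`, so `Φ(H ⊗ 1) = H ⊗ 1`; integral by the isometry ★ `norm_adicCompletionOfLiesOver_of_degree_one`); the one compatibility left to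
check there is `Φ ∘ (c ⊗ 1) = (c' ⊗ 1) ∘ Φ` (naturality of ★ `adicCompletionOfLiesOver` under ★ `galAdicCompletionMap`).  With that `Φ`, THIS file's §5 is
row 21's «letter(L·K, 𝔓) ⇒ letter(L, 𝔭)» for every place-local letter transported by ★ `IrrClass.comap` (admissible, spherical∕unramified; square-integrable and
supercuspidal letters transport the same way along any `≃ₜ*`).

STATEMENTS.  §1 `exists_continuousMulEquiv_unitaryGroupOfForm` (any topological rings `R ≃+* S`, involutions intertwined, `J' = Φ J`).  §2 `exists_continuousMulEquiv_local`
(`«local» E c N J v ≃ₜ* «local» E' c' N J' v'`).  §3 `mem_localIntegralLevel_iff_of_matrix_eq` (level matching for ANY `e` with `e g = Φ g` entrywise and `Φ` integral),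
`map_localIntegralLevel_eq`.  §4 `comap_bijective'`, `isAdmissible_comap_iff'`, `isSpherical_comap_iff'`.  §5 CM dress: **`exists_cmDatum_local_equiv`**,
**`exists_cmDatum_local_equiv_level`** (`∃ e : (cmDatum L N H).Local 𝔭 ≃ₜ* (cmDatum L' N H').Local 𝔓` with the matrix formula AND
`(cmLocalIntegralLevel L N H 𝔭).map e = cmLocalIntegralLevel L' N H' 𝔓`), **`cm_letter_transport`** (classes ↔ classes, admissible ↔ admissible, unramified ↔ unramified).

HONEST LABEL.  HC_CM is proved only modulo the 7 printed citations (2 remaining named inputs: hLiu418 = `stmt-HodgeConjecture-24832`, h413 = `stmt-HodgeConjecture-24833`)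
until rung 0 closes; this file proves no printed statement of [Rogawski1990] and is count-neutral.

## References
* [Rogawski1990] J. Rogawski, *Automorphic representations of unitary groups in three variables*, Ann. of Math. Stud. 123 (1990), §4.7 p. 66, §14.2 p. 232 (the local
  groups `G_v` depend only on the local data) — context of use (row 21 of the K2·E1 TABLE; [Arthur1988InvariantTraceFormulaII, §7] for why `2 ≤ [L⁺:ℚ]` is wanted).
* [PlatonovRapinchuk1994] V. Platonov, A. Rapinchuk, *Algebraic Groups and Number Theory* (1994), §2.3 (equivalent forms, conjugate unitary groups), §5.1 (`G_{𝒪_v}`).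
* [CasselsFrohlichANT1967] J. W. S. Cassels, A. Fröhlich (eds.), *Algebraic Number Theory* (1967), Ch. II §§10–11 (`L ⊗_K K_v = Π_{w ∣ v} L_w`).
* [FrohlichTaylor1990] A. Fröhlich, M. Taylor, *Algebraic Number Theory* (1991), Ch. III §1 (1.14)(a) (`[K_w : F_v] = e f`).
-/

set_option autoImplicit false
set_option linter.dupNamespace false  -- the mandated namespace repeats the summit's segment (`HodgeConjecture.HodgeConjecture`)

noncomputable section

namespace Summit.HodgeConjecture.HodgeConjecture.Cruxes.H413.K2E1GroundFieldChangeLocalIso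

open NumberField IsDedekindDomain Matrix
open scoped MatrixGroups
open Literature.NumberTheory.Automorphic Literature.NumberTheory.Automorphic.UnitaryGroup

/-! ## §1 Transport of `U(σ, J)(R)` along a bicontinuous ring isomorphism `Φ : R ≃+* S` with `Φ ∘ σ = τ ∘ Φ` -/

section Transport

variable {n : Type*} [Fintype n] [DecidableEq n] {R S : Type*} [CommRing R] [CommRing S] [TopologicalSpace R] [TopologicalSpace S]

omit [TopologicalSpace R] [TopologicalSpace S] in
/-- **Membership transport**: for `Φ : R ≃+* S` with `Φ ∘ σ = τ ∘ Φ`, `g ∈ U(σ, J)(R) ⟺ Φ(g) ∈ U(τ, Φ J)(S)` (apply `Φ`, resp. `Φ⁻¹`, entrywise to the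
defining identity `ᵗ(σ g) J g = J`; ★ `map_mem_unitaryGroupOfForm` both ways). [cite: PlatonovRapinchuk1994, §2.3] -/
theorem mem_unitaryGroupOfForm_iff_map_mem (Φ : R ≃+* S) {σ : R →+* R} {τ : S →+* S} (hΦ : ∀ x, Φ (σ x) = τ (Φ x))
    (J : Matrix n n R) (g : GL n R) :
    g ∈ unitaryGroupOfForm σ J ↔ Matrix.GeneralLinearGroup.map (Φ : R →+* S) g ∈ unitaryGroupOfForm τ (J.map Φ) := by
  refine ⟨fun hg => map_mem_unitaryGroupOfForm (Φ : R →+* S) hΦ hg, fun hg => ?_⟩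
  have hΦ' : ∀ y, (Φ.symm : S →+* R) (τ y) = σ ((Φ.symm : S →+* R) y) := fun y => Φ.injective (by
    rw [RingEquiv.coe_toRingHom, hΦ, Φ.apply_symm_apply, Φ.apply_symm_apply])
  have h := map_mem_unitaryGroupOfForm (Φ.symm : S →+* R) hΦ' hg
  have hJ : (J.map Φ).map (Φ.symm : S →+* R) = J := by
    rw [Matrix.map_map]
    exact (Matrix.map_id J ▸ congrArg J.map (funext fun x => Φ.symm_apply_apply x))
  have hg' : Matrix.GeneralLinearGroup.map (Φ.symm : S →+* R) (Matrix.GeneralLinearGroup.map (Φ : R →+* S) g) = g := by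
    ext i j
    exact Φ.symm_apply_apply _
  rwa [hJ, hg'] at h

/-- **`U(σ, J)(R) ≃ₜ* U(τ, Φ J)(S)` along a bicontinuous `Φ : R ≃+* S` intertwining the involutions**, `g ↦ Φ(g)` entrywise (restriction of `GL_n(Φ)`,
★ `ContinuousMulEquiv.restrictSubgroup`); delivered as an existence statement with the matrix formula. [cite: PlatonovRapinchuk1994, §2.3] -/
theorem exists_continuousMulEquiv_unitaryGroupOfForm (Φ : R ≃+* S) (hc : Continuous Φ) (hc' : Continuous Φ.symm)
    {σ : R →+* R} {τ : S →+* S} (hΦ : ∀ x, Φ (σ x) = τ (Φ x)) (J : Matrix n n R) {J' : Matrix n n S} (hJ' : J.map Φ = J') :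
    ∃ e : unitaryGroupOfForm σ J ≃ₜ* unitaryGroupOfForm τ J',
      ∀ g, ((e g : unitaryGroupOfForm τ J') : GL n S) = Matrix.GeneralLinearGroup.map (Φ : R →+* S) g := by
  subst hJ'
  -- `GL_n(Φ) : GL_n(R) ≃ₜ* GL_n(S)` from the bicontinuous matrix isomorphism `Φ.mapMatrix`
  let Ψ : Matrix n n R ≃ₜ* Matrix n n S :=
    { Φ.mapMatrix.toMulEquiv with
      continuous_toFun := continuous_id.matrix_map hc
      continuous_invFun := continuous_id.matrix_map hc' }
  let e₀ : GL n R ≃ₜ* GL n S := Units.mapContinuousMulEquiv Ψ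
  have he₀ : ∀ g : GL n R, e₀ g = Matrix.GeneralLinearGroup.map (Φ : R →+* S) g := fun g => Units.ext rfl
  refine ⟨ContinuousMulEquiv.restrictSubgroup e₀ _ _ fun g => ?_, fun g => ?_⟩
  · rw [he₀]; exact mem_unitaryGroupOfForm_iff_map_mem Φ hΦ J g
  · exact he₀ g

end Transport

/-! ## §2 The local unitary groups `U(J)(F_v) ≤ GL_N(E_v)`: transport along an isomorphism of local data -/

section Local

variable {F E : Type} [Field F] [NumberField F] [Field E] [NumberField E] [Algebra F E] (c : E ≃ₐ[F] E) (N : ℕ)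
  (J : Matrix (Fin N) (Fin N) E) (v : HeightOneSpectrum (𝓞 F))
variable {F' E' : Type} [Field F'] [NumberField F'] [Field E'] [NumberField E'] [Algebra F' E'] (c' : E' ≃ₐ[F'] E')
  (J' : Matrix (Fin N) (Fin N) E') (v' : HeightOneSpectrum (𝓞 F'))

/-- **`U(J)(F_v) ≃ₜ* U(J')(F'_{v'})` along an isomorphism of LOCAL DATA** `Φ : E_v ≃+* E'_{v'}` (bicontinuous, `Φ ∘ (c ⊗ 1) = (c' ⊗ 1) ∘ Φ`, `Φ(J ⊗ 1) = J' ⊗ 1`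
with `J ⊗ 1 = J.map (algebraMap E E_v)`, ★ `local_eq_unitaryGroupOfForm_map`), `g ↦ Φ(g)` entrywise — the local group depends only on the local datum
`(E ⊗_F F_v, c ⊗ 1, J ⊗ 1)` [Rogawski1990 §14.2 «`G′_v` is isomorphic to `G_v`»]. [cite: PlatonovRapinchuk1994, §5.1] [cite: Rogawski1990, §14.2 p. 232] -/
theorem exists_continuousMulEquiv_local (Φ : LocalRing E v ≃+* LocalRing E' v') (hc : Continuous Φ) (hc' : Continuous Φ.symm)
    (hΦσ : ∀ x, Φ (conjLocal E c v x) = conjLocal E' c' v' (Φ x))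
    (hΦJ : (J.map (algebraMap E (LocalRing E v))).map Φ = J'.map (algebraMap E' (LocalRing E' v'))) :
    ∃ e : «local» E c N J v ≃ₜ* «local» E' c' N J' v',
      ∀ g, ((e g : «local» E' c' N J' v') : GL (Fin N) (LocalRing E' v')) = Matrix.GeneralLinearGroup.map (Φ : LocalRing E v →+* LocalRing E' v') (g : GL (Fin N) (LocalRing E v)) := by
  rw [local_eq_unitaryGroupOfForm_map, local_eq_unitaryGroupOfForm_map]
  exact exists_continuousMulEquiv_unitaryGroupOfForm Φ hc hc' hΦσ _ hΦJ

/-! ## §3 Integral levels: `U(J)(𝒪_v) ↦ U(J')(𝒪_{v'})` when `Φ` matches integers -/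

open scoped ValuativeRel in
/-- **Level matching, membership form**: if `Φ` preserves and reflects componentwise integrality (`Φ x` is integral at every `w' ∣ v'` iff `x` is integral at every
`w ∣ v` — automatic for a product of isometries) then ANY isomorphism `e` with `e g = Φ(g)` entrywise satisfies `e g ∈ U(J')(𝒪_{v'}) ⟺ g ∈ U(J)(𝒪_v)`
(★ `mem_localIntegralLevel_iff` + ★ `mem_glInt_iff`: all entries of `g_w` and `g_w⁻¹` integral). [cite: PlatonovRapinchuk1994, §5.1] -/
theorem mem_localIntegralLevel_iff_of_matrix_eq (Φ : LocalRing E v ≃+* LocalRing E' v')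
    (hΦ𝒪 : ∀ x : LocalRing E v, (∀ w' : PlacesOver E' v', Φ x w' ∈ 𝒪[(w'.1).adicCompletion E']) ↔
      ∀ w : PlacesOver E v, x w ∈ 𝒪[(w.1).adicCompletion E])
    (e : «local» E c N J v ≃ₜ* «local» E' c' N J' v')
    (he : ∀ g, ((e g : «local» E' c' N J' v') : GL (Fin N) (LocalRing E' v')) =
      Matrix.GeneralLinearGroup.map (Φ : LocalRing E v →+* LocalRing E' v') (g : GL (Fin N) (LocalRing E v)))
    (g : «local» E c N J v) : e g ∈ localIntegralLevel c' N J' v' ↔ g ∈ localIntegralLevel c N J v := by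
  have h1 : ∀ (w' : PlacesOver E' v') (i j : Fin N),
      ((localGLPiEquiv E' N v' ((e g : «local» E' c' N J' v') : GL (Fin N) (LocalRing E' v')) w' :
          GL (Fin N) ((w'.1).adicCompletion E')) : Matrix (Fin N) (Fin N) ((w'.1).adicCompletion E')) i j =
        Φ (((g : GL (Fin N) (LocalRing E v)) : Matrix (Fin N) (Fin N) (LocalRing E v)) i j) w' := by
    intro w' i j; rw [he]; rfl
  have h2 : ∀ (w' : PlacesOver E' v') (i j : Fin N),
      (((localGLPiEquiv E' N v' ((e g : «local» E' c' N J' v') : GL (Fin N) (LocalRing E' v')) w')⁻¹ :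
          GL (Fin N) ((w'.1).adicCompletion E')) : Matrix (Fin N) (Fin N) ((w'.1).adicCompletion E')) i j =
        Φ ((((g : GL (Fin N) (LocalRing E v))⁻¹ : GL (Fin N) (LocalRing E v)) : Matrix (Fin N) (Fin N) (LocalRing E v)) i j) w' := by
    intro w' i j; rw [he]; rfl
  have h3 : ∀ (w : PlacesOver E v) (i j : Fin N),
      ((localGLPiEquiv E N v (g : GL (Fin N) (LocalRing E v)) w : GL (Fin N) ((w.1).adicCompletion E)) :
          Matrix (Fin N) (Fin N) ((w.1).adicCompletion E)) i j =
        ((g : GL (Fin N) (LocalRing E v)) : Matrix (Fin N) (Fin N) (LocalRing E v)) i j w := fun _ _ _ => rfl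
  have h4 : ∀ (w : PlacesOver E v) (i j : Fin N),
      (((localGLPiEquiv E N v (g : GL (Fin N) (LocalRing E v)) w)⁻¹ : GL (Fin N) ((w.1).adicCompletion E)) :
          Matrix (Fin N) (Fin N) ((w.1).adicCompletion E)) i j =
        (((g : GL (Fin N) (LocalRing E v))⁻¹ : GL (Fin N) (LocalRing E v)) : Matrix (Fin N) (Fin N) (LocalRing E v)) i j w := fun _ _ _ => rfl
  rw [mem_localIntegralLevel_iff, mem_localIntegralLevel_iff]
  simp only [mem_glInt_iff, h1, h2, h3, h4]
  constructor
  · intro h w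
    exact ⟨fun i j => (hΦ𝒪 _).1 (fun w' => (h w').1 i j) w, fun i j => (hΦ𝒪 _).1 (fun w' => (h w').2 i j) w⟩
  · intro h w'
    exact ⟨fun i j => (hΦ𝒪 _).2 (fun w => (h w).1 i j) w', fun i j => (hΦ𝒪 _).2 (fun w => (h w).2 i j) w'⟩

open scoped ValuativeRel in
/-- **Level matching, image form**: under the same hypotheses `e` carries `U(J)(𝒪_v)` ONTO `U(J')(𝒪_{v'})` (the `hmap` of ★ `isSpherical_comap_iff_of_map_eq`).
[cite: PlatonovRapinchuk1994, §5.1] -/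
theorem map_localIntegralLevel_eq (Φ : LocalRing E v ≃+* LocalRing E' v')
    (hΦ𝒪 : ∀ x : LocalRing E v, (∀ w' : PlacesOver E' v', Φ x w' ∈ 𝒪[(w'.1).adicCompletion E']) ↔
      ∀ w : PlacesOver E v, x w ∈ 𝒪[(w.1).adicCompletion E])
    (e : «local» E c N J v ≃ₜ* «local» E' c' N J' v')
    (he : ∀ g, ((e g : «local» E' c' N J' v') : GL (Fin N) (LocalRing E' v')) =
      Matrix.GeneralLinearGroup.map (Φ : LocalRing E v →+* LocalRing E' v') (g : GL (Fin N) (LocalRing E v))) :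
    (localIntegralLevel c N J v).map (e : «local» E c N J v →* «local» E' c' N J' v') = localIntegralLevel c' N J' v' := by
  ext g'
  constructor
  · rintro ⟨g, hg, rfl⟩
    exact (mem_localIntegralLevel_iff_of_matrix_eq c N J v c' J' v' Φ hΦ𝒪 e he g).2 hg
  · intro hg'
    refine ⟨e.symm g', (mem_localIntegralLevel_iff_of_matrix_eq c N J v c' J' v' Φ hΦ𝒪 e he _).1 ?_, e.apply_symm_apply g'⟩
    simpa only [ContinuousMulEquiv.apply_symm_apply] using hg'

/-! ## §4 Transport of classes (★ `IrrClass.comap`): classes, admissible classes, unramified classes correspond -/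

/-- Along ANY `e : U(J)(F_v) ≃ₜ* U(J')(F'_{v'})`, ★ `IrrClass.comap e` is a bijection of irreducible classes. [cite: Rogawski1990, §14.2 p. 232] -/
theorem comap_bijective' (e : «local» E c N J v ≃ₜ* «local» E' c' N J' v') : Function.Bijective (IrrClass.comap e) :=
  IrrClass.comap_bijective _

/-- … preserving admissibility (★ `IrrClass.isAdmissible_comap_iff`). [cite: Rogawski1990, §14.2 p. 232] -/
theorem isAdmissible_comap_iff' (e : «local» E c N J v ≃ₜ* «local» E' c' N J' v') (κ : IrrClass («local» E' c' N J' v')) :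
    (IrrClass.comap e κ).IsAdmissible ↔ κ.IsAdmissible :=
  IrrClass.isAdmissible_comap_iff _ _

open scoped ValuativeRel in
/-- **«unramified ↔ unramified»**: if `e g = Φ(g)` entrywise with `Φ` integral, a class of `U(J')(F'_{v'})` is `U(J')(𝒪_{v'})`-spherical iff its transport is
`U(J)(𝒪_v)`-spherical (★ `isSpherical_comap_iff_of_map_eq` + `map_localIntegralLevel_eq`). [cite: PlatonovRapinchuk1994, §5.1] [cite: Rogawski1990, §14.2 p. 232] -/
theorem isSpherical_comap_iff' (Φ : LocalRing E v ≃+* LocalRing E' v')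
    (hΦ𝒪 : ∀ x : LocalRing E v, (∀ w' : PlacesOver E' v', Φ x w' ∈ 𝒪[(w'.1).adicCompletion E']) ↔
      ∀ w : PlacesOver E v, x w ∈ 𝒪[(w.1).adicCompletion E])
    (e : «local» E c N J v ≃ₜ* «local» E' c' N J' v')
    (he : ∀ g, ((e g : «local» E' c' N J' v') : GL (Fin N) (LocalRing E' v')) =
      Matrix.GeneralLinearGroup.map (Φ : LocalRing E v →+* LocalRing E' v') (g : GL (Fin N) (LocalRing E v)))
    (κ : IrrClass («local» E' c' N J' v')) :
    (IrrClass.comap e κ).IsSpherical (localIntegralLevel c N J v) ↔ κ.IsSpherical (localIntegralLevel c' N J' v') :=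
  IrrClass.isSpherical_comap_iff_of_map_eq _ κ (map_localIntegralLevel_eq c N J v c' J' v' Φ hΦ𝒪 e he)

end Local

/-! ## §5 The CM dress: `(cmDatum L N H).Local 𝔭 ≃ₜ* (cmDatum L' N H').Local 𝔓` and row 21's «letter(L', 𝔓) ⇒ letter(L, 𝔭)» -/

section CM

variable (L : Type) [Field L] [NumberField L] [IsCMField L] (L' : Type) [Field L'] [NumberField L'] [IsCMField L'] (N : ℕ)
  (H : Matrix (Fin N) (Fin N) L) (H' : Matrix (Fin N) (Fin N) L')
  (𝔭 : HeightOneSpectrum (𝓞 ↥(maximalRealSubfield L))) (𝔓 : HeightOneSpectrum (𝓞 ↥(maximalRealSubfield L')))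

/-- **`U(H)(L⁺_𝔭) ≃ₜ* U(H')(L'⁺_𝔓)` in the K2·E1 currency**: an isomorphism of local data `Φ : L ⊗ L⁺_𝔭 ≃+* L' ⊗ L'⁺_𝔓` (bicontinuous, intertwining
`c ⊗ 1` with `c' ⊗ 1`, carrying `H ⊗ 1` to `H' ⊗ 1`) induces `e : (cmDatum L N H).Local 𝔭 ≃ₜ* (cmDatum L' N H').Local 𝔓` with `e g = Φ(g)` entrywise
(stated on the carriers `«local» L c N H 𝔭`, which ARE `(cmDatum L N H).Local 𝔭` — ★ `cmDatum_Local`, `rfl`; `cm_letter_transport` below is typed on `cmDatum`).  For row 21: `L' = L·K`, `H' = H`, `Φ = Π_{w'} ★ adicCompletionEquivOfDegreeOne L L' w w'` at a place `𝔓 ∣ 𝔭` of degree one.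
[cite: Rogawski1990, §14.2 p. 232] [cite: PlatonovRapinchuk1994, §5.1] -/
theorem exists_cmDatum_local_equiv (Φ : LocalRing L 𝔭 ≃+* LocalRing L' 𝔓) (hc : Continuous Φ) (hc' : Continuous Φ.symm)
    (hΦσ : ∀ x, Φ (conjLocal L (IsCMField.complexConj L) 𝔭 x) = conjLocal L' (IsCMField.complexConj L') 𝔓 (Φ x))
    (hΦH : (H.map (algebraMap L (LocalRing L 𝔭))).map Φ = H'.map (algebraMap L' (LocalRing L' 𝔓))) :
    ∃ e : «local» L (IsCMField.complexConj L) N H 𝔭 ≃ₜ* «local» L' (IsCMField.complexConj L') N H' 𝔓,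
      ∀ g, ((e g : «local» L' (IsCMField.complexConj L') N H' 𝔓) : GL (Fin N) (LocalRing L' 𝔓)) =
        Matrix.GeneralLinearGroup.map (Φ : LocalRing L 𝔭 →+* LocalRing L' 𝔓) (g : GL (Fin N) (LocalRing L 𝔭)) :=
  exists_continuousMulEquiv_local (IsCMField.complexConj L) N H 𝔭 (IsCMField.complexConj L') H' 𝔓 Φ hc hc' hΦσ hΦH

open scoped ValuativeRel in
/-- **… carrying `U(H)(𝒪_𝔭)` onto `U(H')(𝒪_𝔓)`** when `Φ` matches integers (★ `cmLocalIntegralLevel` is `localIntegralLevel` by `rfl`): the `ContinuousMulEquiv`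
«commuting with `cmLocalIntegralLevel`» that SURVEY-2 §21 asks for. [cite: PlatonovRapinchuk1994, §5.1] -/
theorem exists_cmDatum_local_equiv_level (Φ : LocalRing L 𝔭 ≃+* LocalRing L' 𝔓) (hc : Continuous Φ) (hc' : Continuous Φ.symm)
    (hΦσ : ∀ x, Φ (conjLocal L (IsCMField.complexConj L) 𝔭 x) = conjLocal L' (IsCMField.complexConj L') 𝔓 (Φ x))
    (hΦH : (H.map (algebraMap L (LocalRing L 𝔭))).map Φ = H'.map (algebraMap L' (LocalRing L' 𝔓)))
    (hΦ𝒪 : ∀ x : LocalRing L 𝔭, (∀ w' : PlacesOver L' 𝔓, Φ x w' ∈ 𝒪[(w'.1).adicCompletion L']) ↔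
      ∀ w : PlacesOver L 𝔭, x w ∈ 𝒪[(w.1).adicCompletion L]) :
    ∃ e : «local» L (IsCMField.complexConj L) N H 𝔭 ≃ₜ* «local» L' (IsCMField.complexConj L') N H' 𝔓,
      (∀ g, ((e g : «local» L' (IsCMField.complexConj L') N H' 𝔓) : GL (Fin N) (LocalRing L' 𝔓)) =
        Matrix.GeneralLinearGroup.map (Φ : LocalRing L 𝔭 →+* LocalRing L' 𝔓) (g : GL (Fin N) (LocalRing L 𝔭))) ∧
      (cmLocalIntegralLevel L N H 𝔭).map
          (e : «local» L (IsCMField.complexConj L) N H 𝔭 →* «local» L' (IsCMField.complexConj L') N H' 𝔓) =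
        cmLocalIntegralLevel L' N H' 𝔓 := by
  obtain ⟨e, he⟩ := exists_cmDatum_local_equiv L L' N H H' 𝔭 𝔓 Φ hc hc' hΦσ hΦH
  exact ⟨e, he, map_localIntegralLevel_eq (IsCMField.complexConj L) N H 𝔭 (IsCMField.complexConj L') H' 𝔓 Φ hΦ𝒪 e he⟩

open scoped ValuativeRel in
/-- **ROW 21's TRANSPORT «letter(L', 𝔓) ⇒ letter(L, 𝔭)»** for the place-local letters: along the isomorphism of local data there is
`e : (cmDatum L N H).Local 𝔭 ≃ₜ* (cmDatum L' N H').Local 𝔓` such that ★ `IrrClass.comap e` is a BIJECTION of irreducible classes preserving ADMISSIBILITY and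
`U(H)(𝒪)`-SPHERICITY («unramified ↔ unramified»). [cite: Rogawski1990, §14.2 p. 232] [cite: PlatonovRapinchuk1994, §5.1] -/
theorem cm_letter_transport (Φ : LocalRing L 𝔭 ≃+* LocalRing L' 𝔓) (hc : Continuous Φ) (hc' : Continuous Φ.symm)
    (hΦσ : ∀ x, Φ (conjLocal L (IsCMField.complexConj L) 𝔭 x) = conjLocal L' (IsCMField.complexConj L') 𝔓 (Φ x))
    (hΦH : (H.map (algebraMap L (LocalRing L 𝔭))).map Φ = H'.map (algebraMap L' (LocalRing L' 𝔓)))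
    (hΦ𝒪 : ∀ x : LocalRing L 𝔭, (∀ w' : PlacesOver L' 𝔓, Φ x w' ∈ 𝒪[(w'.1).adicCompletion L']) ↔
      ∀ w : PlacesOver L 𝔭, x w ∈ 𝒪[(w.1).adicCompletion L]) :
    ∃ e : (cmDatum L N H).Local 𝔭 ≃ₜ* (cmDatum L' N H').Local 𝔓,
      Function.Bijective (IrrClass.comap e) ∧
      (∀ κ : IrrClass ((cmDatum L' N H').Local 𝔓), (IrrClass.comap e κ).IsAdmissible ↔ κ.IsAdmissible) ∧
      (∀ κ : IrrClass ((cmDatum L' N H').Local 𝔓),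
        (IrrClass.comap e κ).IsSpherical (cmLocalIntegralLevel L N H 𝔭) ↔ κ.IsSpherical (cmLocalIntegralLevel L' N H' 𝔓)) := by
  obtain ⟨e, he⟩ := exists_cmDatum_local_equiv L L' N H H' 𝔭 𝔓 Φ hc hc' hΦσ hΦH
  exact ⟨e, IrrClass.comap_bijective _, fun κ => IrrClass.isAdmissible_comap_iff _ _,
    fun κ => isSpherical_comap_iff' (IsCMField.complexConj L) N H 𝔭 (IsCMField.complexConj L') H' 𝔓 Φ hΦ𝒪 e he κ⟩

end CM


end Summit.HodgeConjecture.HodgeConjecture.Cruxes.H413.K2E1GroundFieldChangeLocalIso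

end
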